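import Summits.Ventures.QEC.Census.FoldTowerPlan
import HarnessLib

/-!
# Fold certificate of `[[288,12,18]]` — level-1 ZERO node, file 0: 7 part(s), candidates = segments of `T18`

Kernel computation only (`decide +kernel`, standard axioms); each theorem's work list is a segment of the plan in
`FoldTowerPlan`; assembled in the closer via `FoldTowerSound`.
-/

set_option maxRecDepth 100000

namespace Summit.Ventures.QEC.Census.Fold.Tower

open Summit.Ventures.QEC.Census Summit.Ventures.QEC.Census.Fold

set_option maxHeartbeats 400000000 in
/-- zero node of level 1: the candidates `zseg 0 34` pass `zeroCheckS G1 16 · k1` (est. 44 s). -/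
theorem zero1p0 : zeroCheckS G1 16 (zseg 0 34) k1 = true := by decide +kernel

set_option maxHeartbeats 400000000 in
/-- zero node of level 1: the candidates `zseg 34 10` pass `zeroCheckS G1 16 · k1` (est. 25 s). -/
theorem zero1p1 : zeroCheckS G1 16 (zseg 34 10) k1 = true := by decide +kernel

set_option maxHeartbeats 400000000 in
/-- zero node of level 1: the candidates `zseg 44 20` pass `zeroCheckS G1 16 · k1` (est. 55 s). -/
theorem zero1p2 : zeroCheckS G1 16 (zseg 44 20) k1 = true := by decide +kernel

set_option maxHeartbeats 400000000 in
/-- zero node of level 1: the candidates `zseg 64 70` pass `zeroCheckS G1 16 · k1` (est. 71 s). -/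
theorem zero1p3 : zeroCheckS G1 16 (zseg 64 70) k1 = true := by decide +kernel

set_option maxHeartbeats 400000000 in
/-- zero node of level 1: the candidates `zseg 134 154` pass `zeroCheckS G1 16 · k1` (est. 86 s). -/
theorem zero1p4 : zeroCheckS G1 16 (zseg 134 154) k1 = true := by decide +kernel

set_option maxHeartbeats 400000000 in
/-- zero node of level 1: the candidates `zseg 288 176` pass `zeroCheckS G1 16 · k1` (est. 62 s). -/
theorem zero1p5 : zeroCheckS G1 16 (zseg 288 176) k1 = true := by decide +kernel

set_option maxHeartbeats 400000000 in
/-- zero node of level 1: the candidates `zseg 464 463` pass `zeroCheckS G1 16 · k1` (est. 72 s). -/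
theorem zero1p6 : zeroCheckS G1 16 (zseg 464 463) k1 = true := by decide +kernel


end Summit.Ventures.QEC.Census.Fold.Tower
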